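import Summits.Ventures.PercRepro.C026GluingSigma
import Summits.Ventures.PercRepro.ConnJoin

/-!
# Sigma gluings are part-disciplined (bridge to `C026GluingSigma`)

p6's `sigmaGraph G : MultiGraph V (Σ i, E i)` puts a family of multigraphs side by side; when every
non-terminal vertex carries edges of at most one member (`SharesOnlyAt`, the clause of
`SharesOnlyMarks` / `SharesOnlyTerminals` relative to a terminal set `Cen`), the edge labelling
`pe := Sigma.fst` and a branch map `br` chosen from the edges at each non-terminal satisfy the part
discipline `hpart` of `ConnJoin` — so the join lemma, Lemmas 1–3 and the profile join apply to every
sigma gluing at its terminals (`exists_branchMap_sigma`), and more generally to every multigraph with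
an edge colouring that is constant at each non-terminal (`exists_branchMap_of_oneColour`; p6's
`IsGluing4N`).
-/

namespace PercRepro

namespace MultiGraph

variable {V ι : Type*} {E : ι → Type*}

/-- **Any one-colour-per-non-terminal colouring is part-disciplined** (p6's `IsGluing4N a b c x col`
is this hypothesis with `Cen = {a, b, c, x}`): there is a branch map `br` with every edge at a
non-terminal in that vertex's part. -/
theorem exists_branchMap_of_oneColour {V' E' ι' : Type*} [Inhabited ι'] (G : MultiGraph V' E')
    (Cen : Set V') (pe : E' → ι')
    (hcol : ∀ v, v ∉ Cen → ∀ e e', G.EdgeAt e v → G.EdgeAt e' v → pe e = pe e') :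
    ∃ br : V' → ι', ∀ e, (G.fst e ∉ Cen → pe e = br (G.fst e)) ∧
      (G.snd e ∉ Cen → pe e = br (G.snd e)) := by
  classical
  let br : V' → ι' := fun v => if h : ∃ e, G.EdgeAt e v then pe h.choose else default
  have key : ∀ (e : E') (v : V'), v ∉ Cen → G.EdgeAt e v → pe e = br v := by
    intro e v hv he
    have h : ∃ e, G.EdgeAt e v := ⟨e, he⟩
    simp only [br, dif_pos h]
    exact hcol v hv e h.choose he h.choose_spec
  exact ⟨br, fun e => ⟨fun h => key e _ h (Or.inl rfl), fun h => key e _ h (Or.inr rfl)⟩⟩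

/-- Every vertex outside `Cen` carries edges of at most one member of the family (the clause of
`SharesOnlyMarks` / `SharesOnlyTerminals` for an arbitrary terminal set). -/
def SharesOnlyAt (G : ∀ i, MultiGraph V (E i)) (Cen : Set V) : Prop :=
  ∀ v, v ∉ Cen → ∀ i j (e : E i) (e' : E j), (G i).EdgeAt e v → (G j).EdgeAt e' v → i = j

/-- **Sigma gluings are part-disciplined**: with `pe := Sigma.fst` there is a branch map `br` on the
vertices such that every edge at a non-terminal lies in that vertex's part. -/
theorem exists_branchMap_sigma [Inhabited ι] (G : ∀ i, MultiGraph V (E i)) (Cen : Set V)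
    (hshare : SharesOnlyAt G Cen) :
    ∃ br : V → ι, ∀ e : Σ i, E i,
      ((sigmaGraph G).fst e ∉ Cen → e.1 = br ((sigmaGraph G).fst e)) ∧
        ((sigmaGraph G).snd e ∉ Cen → e.1 = br ((sigmaGraph G).snd e)) := by
  classical
  -- the branch of a vertex: the index of some edge at it, if any
  let br : V → ι := fun v =>
    if h : ∃ i, ∃ e : E i, (G i).EdgeAt e v then h.choose else default
  have key : ∀ (e : Σ i, E i) (v : V), v ∉ Cen → (G e.1).EdgeAt e.2 v → e.1 = br v := by
    intro e v hv he
    have h : ∃ i, ∃ e : E i, (G i).EdgeAt e v := ⟨e.1, e.2, he⟩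
    simp only [br, dif_pos h]
    obtain ⟨e', he'⟩ := h.choose_spec
    exact hshare v hv e.1 h.choose e.2 e' he he'
  refine ⟨br, fun e => ⟨fun h => key e _ h (Or.inl rfl), fun h => key e _ h (Or.inr rfl)⟩⟩

end MultiGraph

end PercRepro
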